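import Summits.HubbardSuperconductivity.HubbardSuperconductivity.Theorems.AnisotropyChordTransferFibre3TwoHoleBSRedSkeleton

/-!
# Route `AnisotropyChord` / H0 rotor rung: inverse-free criteria for the REDUCED skeleton facts on `Fin 2 ⊕ Fin n` (overlapping-cross interface)

Twenty-sixth file of the `TwoHoleBS` (PROP BS) chain; fourth stone of the reduced-slot treatment of the overlapping-cross near classes
(memo HOLE2NEAR-LEAN-g3 §5(a)/§6).  Verbatim generalisation of `…TwoHoleBSCertAlgebra` from the ten slots `Fin 5 ⊕ Fin 5` to a
point family `Fin 2 ⊕ Fin n` with boundary weights `N` (`redPinf A N = [E∞]_live − ½·diag N`):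
* `halfPairK`, `quad_halfPairK`, `cnd_of_formK`, ★ `isUnit_det_of_cndK`, ★ `svecK_pos_of_cnd` (strict CND + zero diagonal + a
  positive entry ⇒ invertible, `s > 0`);
* `mulVec_smInvKinf`, `sum_smInvKinf_mulVec`, ★★ `quad_smInvKinf_ge` (variational principle), `quad_redPinf_eq`
  (`wᵀP∞w = (padK w)ᵀE∞(padK w) − ½ΣN_i w_i²`), `quad_chargeFormK_eq`, ★★ `gap_of_chargeMapK`
  (zero-sum charge map `C` with `(padK w)ᵀ(C+Cᵀ+CᵀAC)(padK w) ≥ g‖w‖² + ½ΣN_iw_i²` ⇒ gap `g` of `P∞` on zero-sum `w`).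
Prover seat `hubbard-h0-rotor-p2` g3; helper for stmt-HubbardSuperconductivity-19089 (`--supports`, helper class).
WHAT THIS IS NOT: nothing here proves superconductivity in the Hubbard model; the rotor TARGET as originally worded stays
FALSE (g15 verdict).  Interface only.  Mathlib + tree imports only; no sorry, no axioms.
-/

set_option linter.dupNamespace false

noncomputable section

open scoped BigOperators
open Complex Finset

namespace Summit.HubbardSuperconductivity.HubbardSuperconductivity.Theorems.AnisotropyChord.Transfer.Fibre3

namespace TwoHoleBS

/-! ## Strict conditional negative definiteness ⇒ invertibility and `s > 0` -/

variable {n : ℕ} (A : Matrix (Fin 2 ⊕ Fin n) (Fin 2 ⊕ Fin n) ℝ)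

/-- the test vector `y = ½(e_p + e_q)`. [folklore] -/
def halfPairK (p q : Fin 2 ⊕ Fin n) : Fin 2 ⊕ Fin n → ℝ := fun r => (if r = p then 1 / 2 else 0) + (if r = q then 1 / 2 else 0)

/-- `Σ y = 1`. [folklore] -/
theorem sum_halfPairK (p q : Fin 2 ⊕ Fin n) : ∑ r, halfPairK p q r = 1 := by
  simp only [halfPairK, Finset.sum_add_distrib, Finset.sum_ite_eq', Finset.mem_univ, if_true]
  norm_num

/-- `yᵀAy = ½A_{pq}` for zero diagonal, symmetric `A`, `p ≠ q`. [folklore] -/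
theorem quad_halfPairK (hsymm : A.IsSymm) (hdiag : ∀ r, A r r = 0) (p q : Fin 2 ⊕ Fin n) :
    dotProduct (halfPairK p q) (A.mulVec (halfPairK p q)) = A p q / 2 := by
  have hqp : A q p = A p q := by simpa using hsymm.apply p q
  have hrow : ∀ r, A.mulVec (halfPairK p q) r = (A r p + A r q) / 2 := by
    intro r
    simp only [Matrix.mulVec, dotProduct, halfPairK, mul_add, mul_ite, mul_zero, Finset.sum_add_distrib, Finset.sum_ite_eq',
      Finset.mem_univ, if_true]
    ring
  have h1 : dotProduct (halfPairK p q) (A.mulVec (halfPairK p q)) = ∑ r, halfPairK p q r * ((A r p + A r q) / 2) :=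
    Finset.sum_congr rfl fun r _ => by rw [hrow]
  rw [h1]
  simp only [halfPairK, add_mul, ite_mul, zero_mul, Finset.sum_add_distrib, Finset.sum_ite_eq', Finset.mem_univ, if_true,
    hdiag, hqp]
  ring

/-- the certificate shape: `vᵀ(−A)v + t(Σv)² − η‖v‖² ≥ 0` for all `v` ⇒ `cᵀAc ≤ −η‖c‖²` on zero-sum `c`. [folklore] -/
theorem cnd_of_formK (t η : ℝ)
    (h : ∀ v : Fin 2 ⊕ Fin n → ℝ, 0 ≤ -dotProduct v (A.mulVec v) + t * (∑ r, v r) ^ 2 - η * dotProduct v v)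
    (c : Fin 2 ⊕ Fin n → ℝ) (hc : ∑ r, c r = 0) : dotProduct c (A.mulVec c) ≤ -η * dotProduct c c := by
  have := h c
  rw [hc] at this
  linarith

/-- ★ **strict CND + zero diagonal + a positive entry ⇒ invertible.** [folklore] -/
theorem isUnit_det_of_cndK (hsymm : A.IsSymm) (hdiag : ∀ r, A r r = 0) {p q : Fin 2 ⊕ Fin n}
    (hpos : 0 < A p q) (η : ℝ) (hη : 0 < η)
    (hcnd : ∀ c : Fin 2 ⊕ Fin n → ℝ, ∑ r, c r = 0 → dotProduct c (A.mulVec c) ≤ -η * dotProduct c c) :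
    IsUnit A.det := by
  rw [isUnit_iff_ne_zero]
  intro hdet
  obtain ⟨v, hv0, hv⟩ := Matrix.exists_mulVec_eq_zero_iff.mpr hdet
  by_cases hS : ∑ r, v r = 0
  · -- zero-sum kernel vector: `0 = vᵀAv ≤ −η‖v‖²`
    have h1 := hcnd v hS
    rw [hv, dotProduct_zero] at h1
    have hnn : 0 ≤ dotProduct v v := Finset.sum_nonneg fun i _ => mul_self_nonneg (v i)
    have hne : dotProduct v v ≠ 0 := fun h => hv0 (dotProduct_self_eq_zero.mp h)
    have h2 : 0 < dotProduct v v := lt_of_le_of_ne hnn hne.symm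
    nlinarith
  · -- otherwise test against `z = y − v/S`
    set S := ∑ r, v r with hSdef
    set y := halfPairK p q with hy
    set z : Fin 2 ⊕ Fin n → ℝ := y - (1 / S) • v with hz
    have hzsum : ∑ r, z r = 0 := by
      simp only [hz, Pi.sub_apply, Pi.smul_apply, smul_eq_mul, Finset.sum_sub_distrib, ← Finset.mul_sum, ← hSdef, hy,
        sum_halfPairK]
      rw [one_div_mul_cancel hS, sub_self]
    have hAz : A.mulVec z = A.mulVec y := by
      rw [hz, Matrix.mulVec_sub, Matrix.mulVec_smul, hv, smul_zero, sub_zero]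
    have hvAy : dotProduct v (A.mulVec y) = 0 := by
      rw [Matrix.dotProduct_mulVec, ← Matrix.mulVec_transpose, hsymm.eq, hv, zero_dotProduct]
    have hquad : dotProduct z (A.mulVec z) = A p q / 2 := by
      rw [hAz, hz, sub_dotProduct, smul_dotProduct, hvAy, smul_zero, sub_zero, hy, quad_halfPairK A hsymm hdiag p q]
    have h1 := hcnd z hzsum
    rw [hquad] at h1
    have h2 : 0 ≤ dotProduct z z := by
      simp only [dotProduct]; exact Finset.sum_nonneg fun i _ => mul_self_nonneg _
    nlinarith

/-- ★ **strict CND + zero diagonal + a positive entry ⇒ `s = 1ᵀA⁻¹1 > 0`.** [folklore] -/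
theorem svecK_pos_of_cnd (hsymm : A.IsSymm) (hdiag : ∀ r, A r r = 0) {p q : Fin 2 ⊕ Fin n}
    (hpos : 0 < A p q) (η : ℝ) (hη : 0 < η)
    (hcnd : ∀ c : Fin 2 ⊕ Fin n → ℝ, ∑ r, c r = 0 → dotProduct c (A.mulVec c) ≤ -η * dotProduct c c) :
    0 < svecK A := by
  have hA := isUnit_det_of_cndK A hsymm hdiag hpos η hη hcnd
  set x := xvecK A with hxdef
  set s := svecK A with hsdef
  have hAx : A.mulVec x = fun _ => 1 := mulVec_xvecK A hA
  have hs_sum : ∑ r, x r = s := rfl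
  have hxAx : dotProduct x (A.mulVec x) = s := by
    rw [hAx]; simp [dotProduct, hs_sum]
  -- `s ≠ 0`
  have hs0 : s ≠ 0 := by
    intro h0
    have h1 := hcnd x (hs_sum.trans h0)
    rw [hxAx, h0] at h1
    have h2 : 0 ≤ dotProduct x x := by
      simp only [dotProduct]; exact Finset.sum_nonneg fun i _ => mul_self_nonneg _
    have h3 : dotProduct x x = 0 := by nlinarith
    have hx0 : x = 0 := by
      funext i
      have := (Finset.sum_eq_zero_iff_of_nonneg (fun j _ => mul_self_nonneg (x j))).mp h3 i (Finset.mem_univ _)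
      exact mul_self_eq_zero.mp this
    have := congrFun hAx p
    rw [hx0, Matrix.mulVec_zero] at this
    norm_num at this
  -- test vector `z = y − x/s`
  set y := halfPairK p q with hy
  set z : Fin 2 ⊕ Fin n → ℝ := y - (1 / s) • x with hz
  have hzsum : ∑ r, z r = 0 := by
    simp only [hz, Pi.sub_apply, Pi.smul_apply, smul_eq_mul, Finset.sum_sub_distrib, ← Finset.mul_sum, hs_sum, hy,
      sum_halfPairK]
    rw [one_div_mul_cancel hs0, sub_self]
  have hyAx : dotProduct y (A.mulVec x) = 1 := by
    rw [hAx]; simp only [dotProduct, mul_one, hy, sum_halfPairK]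
  have hxAy : dotProduct x (A.mulVec y) = 1 := by
    rw [Matrix.dotProduct_mulVec, ← Matrix.mulVec_transpose, hsymm.eq, dotProduct_comm, hyAx]
  have hquad : dotProduct z (A.mulVec z) = A p q / 2 - 1 / s := by
    rw [hz, Matrix.mulVec_sub, Matrix.mulVec_smul, sub_dotProduct, dotProduct_sub, dotProduct_sub, smul_dotProduct,
      smul_dotProduct, dotProduct_smul, dotProduct_smul, hxAx, hyAx, hxAy, hy, quad_halfPairK A hsymm hdiag p q]
    simp only [smul_eq_mul]
    field_simp
    ring
  have h1 := hcnd z hzsum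
  rw [hquad] at h1
  have h2 : 0 ≤ dotProduct z z := by
    simp only [dotProduct]; exact Finset.sum_nonneg fun i _ => mul_self_nonneg _
  have h3 : A p q / 2 - 1 / s ≤ 0 := by nlinarith
  have h4 : 0 < 1 / s := by linarith
  exact one_div_pos.mp h4

/-! ## The variational principle for `E∞ = −A⁻¹ + x xᵀ/s` and the gap of `P∞` from a zero-sum charge map -/

/-- `A · E∞ y = −y + (x·y/s)·1`. [folklore] -/
theorem mulVec_smInvKinf (hA : IsUnit A.det) (y : Fin 2 ⊕ Fin n → ℝ) :
    A.mulVec ((smInvKinf A).mulVec y)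
      = -y + (dotProduct (xvecK A) y / svecK A) • (fun _ => (1 : ℝ)) := by
  unfold smInvKinf
  rw [Matrix.add_mulVec, Matrix.neg_mulVec, Matrix.mulVec_add, Matrix.mulVec_neg, Matrix.mulVec_mulVec,
    Matrix.mul_nonsing_inv _ hA, Matrix.one_mulVec, Matrix.smul_mulVec, Matrix.mulVec_smul]
  congr 1
  have h : (Matrix.vecMulVec (xvecK A) (xvecK A)).mulVec y
      = dotProduct (xvecK A) y • xvecK A := by
    funext i
    simp only [Matrix.mulVec, dotProduct, Matrix.vecMulVec_apply, Pi.smul_apply, smul_eq_mul]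
    rw [Finset.sum_mul]
    exact Finset.sum_congr rfl fun j _ => by ring
  rw [h, Matrix.mulVec_smul, mulVec_xvecK A hA, smul_smul]
  congr 1
  ring

/-- `Σ (E∞ y) = 0` (symmetric `A`). [folklore] -/
theorem sum_smInvKinf_mulVec (hsymm : A.IsSymm) (hs : svecK A ≠ 0)
    (y : Fin 2 ⊕ Fin n → ℝ) : ∑ r, (smInvKinf A).mulVec y r = 0 := by
  have h1 : ∑ r, (smInvKinf A).mulVec y r = dotProduct (fun _ => (1 : ℝ)) ((smInvKinf A).mulVec y) := by
    simp [dotProduct]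
  rw [h1]
  unfold smInvKinf
  rw [Matrix.add_mulVec, Matrix.neg_mulVec, dotProduct_add, dotProduct_neg, Matrix.dotProduct_mulVec,
    one_vecMul_invK A hsymm, Matrix.smul_mulVec, dotProduct_smul]
  have h : dotProduct (fun _ => (1 : ℝ)) ((Matrix.vecMulVec (xvecK A) (xvecK A)).mulVec y)
      = svecK A * dotProduct (xvecK A) y := by
    simp only [dotProduct, Matrix.mulVec, Matrix.vecMulVec_apply, one_mul, svecK]
    rw [Finset.sum_mul]
    refine Finset.sum_congr rfl fun i _ => ?_
    rw [Finset.mul_sum]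
    exact Finset.sum_congr rfl fun j _ => by ring
  rw [h, smul_eq_mul]
  field_simp
  ring

/-- ★★ **VARIATIONAL PRINCIPLE:** for symmetric invertible `A`, conditionally negative semidefinite, with `s ≠ 0`: every ZERO-SUM
charge `c` gives a lower bound `2c·y + cᵀAc ≤ yᵀE∞y` (equality at `c = E∞y`). [folklore] -/
theorem quad_smInvKinf_ge (hsymm : A.IsSymm) (hA : IsUnit A.det) (hs : svecK A ≠ 0)
    (hcnd0 : ∀ c : Fin 2 ⊕ Fin n → ℝ, ∑ r, c r = 0 → dotProduct c (A.mulVec c) ≤ 0)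
    (y c : Fin 2 ⊕ Fin n → ℝ) (hc : ∑ r, c r = 0) :
    2 * dotProduct c y + dotProduct c (A.mulVec c) ≤ dotProduct y ((smInvKinf A).mulVec y) := by
  set cs := (smInvKinf A).mulVec y with hcs
  set κ := dotProduct (xvecK A) y / svecK A with hκ
  have hAcs : A.mulVec cs = -y + κ • (fun _ => (1 : ℝ)) := mulVec_smInvKinf A hA y
  have hsum_cs : ∑ r, cs r = 0 := sum_smInvKinf_mulVec A hsymm hs y
  have hdiff : ∑ r, (c - cs) r = 0 := by
    simp only [Pi.sub_apply, Finset.sum_sub_distrib, hc, hsum_cs, sub_zero]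
  have key := hcnd0 (c - cs) hdiff
  -- expand `(c − c*)ᵀA(c − c*)`
  have hc1 : dotProduct c (fun _ => (1 : ℝ)) = 0 := by simp [dotProduct, hc]
  have hcs1 : dotProduct cs (fun _ => (1 : ℝ)) = 0 := by simp [dotProduct, hsum_cs]
  have hcAcs : dotProduct c (A.mulVec cs) = -dotProduct c y := by
    rw [hAcs, dotProduct_add, dotProduct_neg, dotProduct_smul, hc1, smul_zero, add_zero]
  have hcsAc : dotProduct cs (A.mulVec c) = -dotProduct c y := by
    rw [Matrix.dotProduct_mulVec, ← Matrix.mulVec_transpose, hsymm.eq, dotProduct_comm, hcAcs]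
  have hcsAcs : dotProduct cs (A.mulVec cs) = -dotProduct cs y := by
    rw [hAcs, dotProduct_add, dotProduct_neg, dotProduct_smul, hcs1, smul_zero, add_zero]
  rw [Matrix.mulVec_sub, sub_dotProduct, dotProduct_sub, dotProduct_sub, hcAcs, hcsAc, hcsAcs] at key
  rw [dotProduct_comm y cs]
  linarith

/-- `wᵀP∞w = (padK w)ᵀE∞(padK w) − ½ΣN_i w_i²`. [folklore] -/
theorem quad_redPinf_eq (N : Fin n → ℝ) (w : Fin n → ℝ) :
    dotProduct w ((redPinf A N).mulVec w)
      = dotProduct (padK w) ((smInvKinf A).mulVec (padK w)) - (1 / 2) * ∑ i, N i * w i ^ 2 := by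
  have hE : dotProduct (padK w) ((smInvKinf A).mulVec (padK w))
      = ∑ i : Fin n, ∑ j : Fin n, w i * smInvKinf A (Sum.inr i) (Sum.inr j) * w j := by
    unfold dotProduct
    rw [sum_eq_sum_inr (F := fun p => padK w p * (smInvKinf A).mulVec (padK w) p) (fun c => by simp [padK])]
    refine Finset.sum_congr rfl fun i _ => ?_
    rw [mulVec_apply_sum, sum_eq_sum_inr (F := fun q => smInvKinf A (Sum.inr i) q * padK w q) (fun c => by simp [padK])]
    simp only [padK, Sum.elim_inr, Finset.mul_sum]
    exact Finset.sum_congr rfl fun j _ => by ring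
  rw [hE]
  have h1 : ∀ i, (redPinf A N).mulVec w i
      = (∑ j, smInvKinf A (Sum.inr i) (Sum.inr j) * w j) - N i / 2 * w i := by
    intro i
    rw [mulVec_apply_sum]
    simp only [redPinf, Matrix.of_apply, sub_mul, Finset.sum_sub_distrib, ite_mul, zero_mul, Finset.sum_ite_eq,
      Finset.mem_univ, if_true]
  have h2 : dotProduct w ((redPinf A N).mulVec w)
      = ∑ i, (w i * ∑ j, smInvKinf A (Sum.inr i) (Sum.inr j) * w j) - ∑ i, w i * (N i / 2 * w i) := by
    simp only [dotProduct, h1, mul_sub, Finset.sum_sub_distrib]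
  rw [h2]
  congr 1
  · exact Finset.sum_congr rfl fun i _ => by rw [Finset.mul_sum]; exact Finset.sum_congr rfl fun j _ => by ring
  · rw [Finset.mul_sum]
    exact Finset.sum_congr rfl fun i _ => by ring

/-- the charge quadratic form: `uᵀ(C + Cᵀ + CᵀAC)u = 2(Cu)·u + (Cu)ᵀA(Cu)`. [folklore] -/
theorem quad_chargeFormK_eq (C : Matrix (Fin 2 ⊕ Fin n) (Fin 2 ⊕ Fin n) ℝ) (u : Fin 2 ⊕ Fin n → ℝ) :
    dotProduct u ((C + C.transpose + C.transpose * A * C).mulVec u)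
      = 2 * dotProduct (C.mulVec u) u + dotProduct (C.mulVec u) (A.mulVec (C.mulVec u)) := by
  rw [Matrix.add_mulVec, Matrix.add_mulVec, dotProduct_add, dotProduct_add, ← Matrix.mulVec_mulVec,
    ← Matrix.mulVec_mulVec, Matrix.dotProduct_mulVec u C.transpose, Matrix.vecMul_transpose,
    Matrix.dotProduct_mulVec u C.transpose, Matrix.vecMul_transpose, dotProduct_comm u (C.mulVec u)]
  ring

/-- ★★ **THE GAP OF THE REDUCED MAP FROM A ZERO-SUM CHARGE MAP:** symmetric invertible CND `A` with `s ≠ 0`; a matrix `C` with zero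
column sums such that `(padK w)ᵀ(C + Cᵀ + CᵀAC)(padK w) ≥ g‖w‖² + ½ΣN_i w_i²` for zero-sum `w` ⇒ `wᵀP∞w ≥ g‖w‖²` on zero-sum `w`. [folklore] -/
theorem gap_of_chargeMapK (hsymm : A.IsSymm) (hA : IsUnit A.det) (hs : svecK A ≠ 0)
    (hcnd0 : ∀ c : Fin 2 ⊕ Fin n → ℝ, ∑ r, c r = 0 → dotProduct c (A.mulVec c) ≤ 0)
    (C : Matrix (Fin 2 ⊕ Fin n) (Fin 2 ⊕ Fin n) ℝ) (hC : ∀ q, ∑ p, C p q = 0) (N : Fin n → ℝ) (g : ℝ)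
    (hM : ∀ w : Fin n → ℝ, ∑ i, w i = 0 →
      g * dotProduct w w + (1 / 2) * ∑ i, N i * w i ^ 2
        ≤ dotProduct (padK w) ((C + C.transpose + C.transpose * A * C).mulVec (padK w)))
    (w : Fin n → ℝ) (hw : ∑ i, w i = 0) :
    g * dotProduct w w ≤ dotProduct w ((redPinf A N).mulVec w) := by
  set c := C.mulVec (padK w) with hc
  have hcsum : ∑ r, c r = 0 := by
    simp only [hc, mulVec_apply_sum]
    rw [Finset.sum_comm]
    refine Finset.sum_eq_zero fun q _ => ?_
    rw [← Finset.sum_mul, hC q, zero_mul]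
  have h1 := hM w hw
  rw [quad_chargeFormK_eq] at h1
  have h2 := quad_smInvKinf_ge A hsymm hA hs hcnd0 (padK w) c hcsum
  rw [quad_redPinf_eq]
  linarith

end TwoHoleBS

end Summit.HubbardSuperconductivity.HubbardSuperconductivity.Theorems.AnisotropyChord.Transfer.Fibre3

end
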